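import Summits.Schanuel.Schanuel.Theses.DiophantineDichotomy
import Summits.Schanuel.Schanuel.Theorems.EPiSimultaneousType.Negative.CoordinatewiseLinear

/-!
# No single real number has a polynomial measure with degree exponent `a < 1` (Dirichlet's box)
(negative lemma for crux `EPiSimultaneousType`, stmt-Schanuel-6118, route DiophantineDichotomy;
cdisprove cycle 2 — calibration of the line `compositum-defect-split`)

* `EPiSimultaneousType.exists_intPoly_small_at` — DIRICHLET'S BOX PRINCIPLE for polynomials: for
  real `ξ`, `d ≥ 1`, `H ≥ 2` there is a non-zero `P ∈ ℤ[X]`, `deg P ≤ d`, naive height `≤ H`, with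
  `|P(ξ)| ≤ 4(d+1)·max(1,|ξ|)^d / H^d` (pigeonhole on the `(H+1)^{d+1}` values `Σ cᵢ ξⁱ`,
  `0 ≤ cᵢ ≤ H`).
* `real_polyMeasure_false_of_exponent_lt_one` — hence for every real `ξ` and every `a < 1` there
  are NO `b, C` with `|P(ξ)| ≥ exp(−C(dᵃ log H + dᵇ))` for all non-zero `P` of degree `≤ d` and
  height `≤ H` (the template `PolyMeasure ξ a` of `Lines/compositum-defect-split.lean`): the
  single-variable inputs of any proof of the crux carry exponent `a ≥ 1` — for `π` AND for `e` —
  so thresholds `s₁, s₂ < 1` in the entangled core can never be pushed to `1` by improving them;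
  `polyMeasure_shape_false_of_exponent_lt_one` is the same in the skeleton's exact shape
  (`ξ : ℂ` real, `0 < C`).

Everything is proved (definition-free); axioms `propext`, `Classical.choice`, `Quot.sound`.
-/

set_option linter.dupNamespace false

noncomputable section

namespace Summit.Schanuel.Schanuel.Theorems

open Polynomial

namespace EPiSimultaneousType

/-- **Dirichlet's box principle for integer polynomials at a real point**: for `d ≥ 1`, `H ≥ 2`
there is `P ∈ ℤ[X] ∖ {0}`, `deg P ≤ d`, `|coeff| ≤ H`, with `|P(ξ)| ≤ 4(d+1)max(1,|ξ|)^d / H^d`.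
[folklore] -/
theorem exists_intPoly_small_at (ξ : ℝ) {d H : ℕ} (hd : 1 ≤ d) (hH : 2 ≤ H) :
    ∃ P : Polynomial ℤ, P ≠ 0 ∧ P.natDegree ≤ d ∧ (∀ k, |P.coeff k| ≤ (H : ℤ)) ∧
      |Polynomial.aeval ξ P| ≤ 4 * (d + 1) * max 1 |ξ| ^ d / (H : ℝ) ^ d := by
  set R : ℝ := max 1 |ξ| with hR
  have hR1 : 1 ≤ R := le_max_left _ _
  have hR0 : 0 < R := by linarith
  have hξR : |ξ| ≤ R := le_max_right _ _
  -- the box of coefficient vectors and their values at ξ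
  let val : (Fin (d + 1) → Fin (H + 1)) → ℝ := fun c => ∑ i : Fin (d + 1), ((c i : ℕ) : ℝ) * ξ ^ (i : ℕ)
  set B : ℝ := (d + 1) * H * R ^ d with hB
  have hHpos : (0 : ℝ) < H := by exact_mod_cast (by omega : 0 < H)
  have hBpos : 0 < B := by positivity
  have hval : ∀ c, |val c| ≤ B := by
    intro c
    calc |val c| ≤ ∑ i : Fin (d + 1), |((c i : ℕ) : ℝ) * ξ ^ (i : ℕ)| := Finset.abs_sum_le_sum_abs _ _
      _ ≤ ∑ _i : Fin (d + 1), (H : ℝ) * R ^ d := by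
          apply Finset.sum_le_sum
          intro i _
          rw [abs_mul, abs_pow]
          have hc : ((c i : ℕ) : ℝ) ≤ H := by
            have := (c i).isLt
            exact_mod_cast (by omega : (c i : ℕ) ≤ H)
          have hc0 : (0 : ℝ) ≤ ((c i : ℕ) : ℝ) := by positivity
          rw [abs_of_nonneg hc0]
          apply mul_le_mul hc _ (by positivity) hHpos.le
          calc |ξ| ^ (i : ℕ) ≤ R ^ (i : ℕ) := pow_le_pow_left₀ (abs_nonneg ξ) hξR _
            _ ≤ R ^ d := pow_le_pow_right₀ hR1 (by omega)
      _ = B := by simp [hB]; ring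
  -- pigeonhole: N = (H+1)^(d+1) vectors, buckets ⌊val/η⌋ ∈ [-K, K], η = 4B/N
  set N : ℕ := (H + 1) ^ (d + 1) with hN
  have hN7 : 7 ≤ N := by
    have h3 : 3 ≤ H + 1 := by omega
    calc 7 ≤ 3 ^ 2 := by norm_num
      _ ≤ (H + 1) ^ 2 := Nat.pow_le_pow_left h3 2
      _ ≤ (H + 1) ^ (d + 1) := Nat.pow_le_pow_right (by omega) (by omega)
  have hNpos : (0 : ℝ) < N := by exact_mod_cast (by omega : 0 < N)
  set η : ℝ := 4 * B / N with hη
  have hηpos : 0 < η := by positivity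
  set K : ℤ := ⌈B / η⌉ with hK
  have hBη : B / η = N / 4 := by
    rw [hη]; field_simp
  have hK0 : 0 ≤ K := by rw [hK]; exact Int.ceil_nonneg (by positivity)
  have hmaps : ∀ c, ⌊val c / η⌋ ∈ Finset.Icc (-K) K := by
    intro c
    have h := hval c
    rw [abs_le] at h
    rw [Finset.mem_Icc]
    constructor
    · -- -K ≤ ⌊val/η⌋  since val/η ≥ -B/η ≥ -⌈B/η⌉
      have h1 : -(B / η) ≤ val c / η := by
        rw [← neg_div]; exact div_le_div_of_nonneg_right h.1 hηpos.le
      have h2 : (-K : ℤ) ≤ ⌊val c / η⌋ := by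
        rw [Int.le_floor]
        push_cast
        have : (B / η) ≤ (K : ℝ) := Int.le_ceil _
        linarith
      exact h2
    · rw [← Int.lt_add_one_iff, Int.floor_lt]  -- ⌊val/η⌋ ≤ K ↔ ⌊val/η⌋ < K+1 ↔ val/η < K+1
      push_cast
      have : val c / η ≤ B / η := div_le_div_of_nonneg_right h.2 hηpos.le
      have : (B / η) ≤ (K : ℝ) := Int.le_ceil _
      linarith
  have hcard : (Finset.Icc (-K) K).card < (Finset.univ : Finset (Fin (d + 1) → Fin (H + 1))).card := by
    rw [Finset.card_univ, Fintype.card_fun, Fintype.card_fin, Fintype.card_fin, Int.card_Icc]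
    -- (K + 1 - -K).toNat = 2K+1 < N : from K ≤ N/4 + 1 and N ≥ 7
    have hKle : (K : ℝ) < N / 4 + 1 := by
      have h1 : (K : ℝ) < B / η + 1 := by rw [hK]; exact Int.ceil_lt_add_one _
      rw [hBη] at h1
      exact h1
    have h2K : ((K + 1 - -K).toNat : ℤ) = 2 * K + 1 := by
      rw [Int.toNat_of_nonneg (by omega)]; ring
    have hreal : (2 * (K : ℝ) + 1) < N := by
      have hN7' : (7 : ℝ) ≤ N := by exact_mod_cast hN7
      linarith
    have hint : 2 * K + 1 < (N : ℤ) := by exact_mod_cast hreal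
    have : ((K + 1 - -K).toNat : ℤ) < (N : ℤ) := by rw [h2K]; exact hint
    rw [hN] at this
    exact_mod_cast this
  obtain ⟨c, -, c', -, hne, hcc⟩ :=
    Finset.exists_ne_map_eq_of_card_lt_of_maps_to hcard (f := fun c => ⌊val c / η⌋)
      (fun c _ => hmaps c)
  -- the difference polynomial
  have hclose : |val c - val c'| < η := by
    have h := Int.abs_sub_lt_one_of_floor_eq_floor hcc
    rw [← sub_div, abs_div, abs_of_pos hηpos, div_lt_one hηpos] at h
    exact h
  let e : ℕ → ℤ := fun i => if h : i < d + 1 then ((c ⟨i, h⟩ : ℕ) : ℤ) - ((c' ⟨i, h⟩ : ℕ) : ℤ) else 0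
  set P : Polynomial ℤ := ∑ i ∈ Finset.range (d + 1), Polynomial.C (e i) * Polynomial.X ^ i with hP
  have hcoeff : ∀ k, P.coeff k = if k < d + 1 then e k else 0 := by
    intro k
    simp only [hP, Polynomial.finsetSum_coeff, Polynomial.coeff_C_mul_X_pow]
    rw [Finset.sum_ite_eq]
    simp only [Finset.mem_range]
  refine ⟨P, ?_, ?_, ?_, ?_⟩
  · -- P ≠ 0: c ≠ c'
    intro h0
    apply hne
    funext i
    have hk := hcoeff i
    rw [h0, Polynomial.coeff_zero, if_pos i.isLt] at hk
    have : e i = 0 := hk.symm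
    simp only [e, dif_pos i.isLt, Fin.eta] at this
    exact Fin.ext (by omega)
  · rw [Polynomial.natDegree_le_iff_coeff_eq_zero]
    intro m hm
    rw [hcoeff, if_neg]
    omega
  · intro k
    rw [hcoeff]
    split_ifs with hk
    · simp only [e, dif_pos hk]
      have h1 := (c ⟨k, hk⟩).isLt
      have h2 := (c' ⟨k, hk⟩).isLt
      rw [abs_le]
      constructor <;> omega
    · simp
  · -- |P(ξ)| = |val c - val c'| < η ≤ 4(d+1)R^d/H^d
    have heval : Polynomial.aeval ξ P = val c - val c' := by
      simp only [hP, map_sum, map_mul, Polynomial.aeval_C, Polynomial.aeval_X_pow]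
      simp only [algebraMap_int_eq, eq_intCast, val]
      rw [← Finset.sum_sub_distrib, Finset.sum_range (fun i => ((e i : ℤ) : ℝ) * ξ ^ i)]
      apply Finset.sum_congr rfl
      intro i _
      simp only [e, dif_pos i.isLt, Fin.eta, Int.cast_sub, Int.cast_natCast]
      ring
    rw [heval]
    refine hclose.le.trans ?_
    -- η = 4B/N = 4(d+1) H R^d / (H+1)^(d+1) ≤ 4(d+1)R^d/H^d
    have hNeq : (N : ℝ) = ((H : ℝ) + 1) ^ (d + 1) := by rw [hN]; push_cast; ring
    have hkey : (H : ℝ) * (H : ℝ) ^ d ≤ ((H : ℝ) + 1) ^ (d + 1) := by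
      rw [← pow_succ']
      exact pow_le_pow_left₀ hHpos.le (by linarith) _
    rw [hη, hB, div_le_div_iff₀ hNpos (pow_pos hHpos d), hNeq]
    calc 4 * (((d : ℝ) + 1) * H * R ^ d) * (H : ℝ) ^ d
        = 4 * ((d : ℝ) + 1) * R ^ d * ((H : ℝ) * (H : ℝ) ^ d) := by ring
      _ ≤ 4 * ((d : ℝ) + 1) * R ^ d * ((H : ℝ) + 1) ^ (d + 1) := by gcongr

end EPiSimultaneousType

open EPiSimultaneousType

/-- **No real number has a polynomial measure with degree exponent `a < 1`** (any `b`, any real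
`C`): given `b, C`, pick `d` with `d − |C|d^{max(a,0)} ≥ 1` and then `H` with
`log H > |C|d^b + log(4(d+1)max(1,|ξ|)^d)`; Dirichlet's polynomial beats the bound. So the
single-variable inputs `PolyMeasure π a₁`, `PolyMeasure e a₂` of the line `compositum-defect-split`
exist only for `a₁, a₂ ≥ 1` (as the printed profiles have: `1+ε` for `π`, `2` for `e`), and its
`stub_pointMeasure_of_polyMeasure` is vacuous below `a = 1`. [folklore] -/
theorem real_polyMeasure_false_of_exponent_lt_one (ξ : ℝ) {a : ℝ} (ha : a < 1) :
    ¬ ∃ b C : ℝ, ∀ (d H : ℕ) (P : Polynomial ℤ), 1 ≤ d → P ≠ 0 → P.natDegree ≤ d →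
      (∀ k, |P.coeff k| ≤ (H : ℤ)) →
        Real.exp (-(C * ((d : ℝ) ^ a * Real.log H + (d : ℝ) ^ b))) ≤ |Polynomial.aeval ξ P| := by
  rintro ⟨b, C, hM⟩
  set s : ℝ := max a 0 with hsdef
  have hs0 : 0 ≤ s := le_max_right _ _
  have hs1 : s < 1 := max_lt ha one_pos
  have has : a ≤ s := le_max_left _ _
  obtain ⟨d, hd1, hd⟩ := exists_nat_linear_beats_rpow (C' := |C|) one_pos hs0 hs1
  rw [one_mul] at hd
  set R : ℝ := max 1 |ξ| with hR
  set Q : ℝ := 4 * (d + 1) * R ^ d with hQ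
  have hQpos : 0 < Q := by positivity
  set M : ℝ := |C| * (d : ℝ) ^ b + Real.log Q with hMdef
  set H : ℕ := ⌈Real.exp M⌉₊ + 2 with hHdef
  have hH2 : 2 ≤ H := Nat.le_add_left 2 _
  have hHpos : (0 : ℝ) < H := by exact_mod_cast (by omega : 0 < H)
  have hlogH : M < Real.log H := by
    rw [← Real.exp_lt_exp, Real.exp_log hHpos]
    have h1 : Real.exp M ≤ ⌈Real.exp M⌉₊ := Nat.le_ceil _
    have h2 : ((⌈Real.exp M⌉₊ + 2 : ℕ) : ℝ) = H := by rw [hHdef]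
    push_cast at h2
    linarith
  have hlog0 : 0 < Real.log H := Real.log_pos (by exact_mod_cast (by omega : 1 < H))
  obtain ⟨P, hP0, hdeg, hcoeff, hsmall⟩ := exists_intPoly_small_at ξ hd1 hH2
  have hmeas := hM d H P hd1 hP0 hdeg hcoeff
  have hd1' : (1 : ℝ) ≤ d := by exact_mod_cast hd1
  -- Q / H^d < the bound
  have hlt : Q / (H : ℝ) ^ d < Real.exp (-(C * ((d : ℝ) ^ a * Real.log H + (d : ℝ) ^ b))) := by
    have hL : Q / (H : ℝ) ^ d = Real.exp (Real.log Q - d * Real.log H) := by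
      rw [Real.exp_sub, Real.exp_log hQpos, ← Real.log_pow, Real.exp_log (pow_pos hHpos d)]
    rw [hL, Real.exp_lt_exp]
    have hda : (d : ℝ) ^ a ≤ (d : ℝ) ^ s := Real.rpow_le_rpow_of_exponent_le hd1' has
    have hdb : 0 < (d : ℝ) ^ b := by positivity
    have h1 : C * ((d : ℝ) ^ a * Real.log H + (d : ℝ) ^ b) ≤
        |C| * (d : ℝ) ^ s * Real.log H + |C| * (d : ℝ) ^ b := by
      have h0 : 0 ≤ (d : ℝ) ^ a * Real.log H + (d : ℝ) ^ b := by positivity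
      calc C * ((d : ℝ) ^ a * Real.log H + (d : ℝ) ^ b)
          ≤ |C| * ((d : ℝ) ^ a * Real.log H + (d : ℝ) ^ b) := by gcongr; exact le_abs_self C
        _ ≤ |C| * ((d : ℝ) ^ s * Real.log H + (d : ℝ) ^ b) := by gcongr
        _ = _ := by ring
    have h3 := mul_nonneg (by linarith : (0 : ℝ) ≤ d - |C| * (d : ℝ) ^ s - 1) hlog0.le
    rw [hMdef] at hlogH
    nlinarith
  have : Q / (H : ℝ) ^ d < Q / (H : ℝ) ^ d := by
    calc Q / (H : ℝ) ^ d < _ := hlt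
      _ ≤ |Polynomial.aeval ξ P| := hmeas
      _ ≤ 4 * (d + 1) * max 1 |ξ| ^ d / (H : ℝ) ^ d := hsmall
      _ = Q / (H : ℝ) ^ d := by rw [hQ, hR]
  exact lt_irrefl _ this

/-- The same in the exact shape of `PolyMeasure (ξ : ℂ) a` of `Lines/compositum-defect-split.lean`
(real `ξ` cast to `ℂ`, with its `0 < C`): false for every `a < 1`. [folklore] -/
theorem polyMeasure_shape_false_of_exponent_lt_one (ξ : ℝ) {a : ℝ} (ha : a < 1) :
    ¬ ∃ b C : ℝ, 0 < C ∧ ∀ (d H : ℕ) (P : Polynomial ℤ), 1 ≤ d → P ≠ 0 → P.natDegree ≤ d →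
      (∀ k, |P.coeff k| ≤ (H : ℤ)) →
        Real.exp (-(C * ((d : ℝ) ^ a * Real.log H + (d : ℝ) ^ b))) ≤
          ‖Polynomial.aeval (ξ : ℂ) P‖ := by
  rintro ⟨b, C, -, hM⟩
  apply real_polyMeasure_false_of_exponent_lt_one ξ ha
  refine ⟨b, C, fun d H P hd hP hdeg hH => ?_⟩
  have h := hM d H P hd hP hdeg hH
  rw [show (ξ : ℂ) = algebraMap ℝ ℂ ξ from rfl, Polynomial.aeval_algebraMap_apply] at h
  simpa only [Complex.coe_algebraMap, Complex.norm_real, Real.norm_eq_abs] using h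

end Summit.Schanuel.Schanuel.Theorems

end
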